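import Summits.BirchSwinnertonDyer.BirchSwinnertonDyer.Theorems.ManinLocalTwoThreeTameThreeTorsionAscends
import Summits.BirchSwinnertonDyer.BirchSwinnertonDyer.Theorems.ManinLocalTwoThreeNoAscendingOfTypeIIILaw
import HarnessLib

/-!
# The WILD band at `3`: a rational `3`-torsion point ascends iff `ord₃ Δ_min ∈ {5, 11}` — so NB₃^V-wild is the
# Kodaira POSITION LAW «no optimal `W` with `27 ∣ N` and a rational `3`-torsion point has `ord₃ Δ_min ∈ {5, 11}`»

Summit `BirchSwinnertonDyer`, route `ManinLocalTwoThree` (cell bsd-f2-manin), deciding crux C3 `ManinPrimeToThreeAtNine`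
(stmt-BirchSwinnertonDyer-22968), line `kato_shift_three`, skeleton v15 (lead p1 gen 7): stub NB₃^V `NoAscendingThreeTorsionOptimal`
was split into an's tame position law T3III (stub 4b^T) and the inline WILD remainder NB₃^V-wild (stub 4b^W: no optimal `W`,
`9 ∣ N`, `27 ∣ N(W)`, has a rational `3`-torsion point `T = (X₁, Y₁)` on `E♮` whose Vélu `3`-quotient ascends).  The tame half is
exact (`…TameThreeTorsionAscends`: T3III ⟺ NB₃^V|tame).  THIS FILE does the same for the wild half, on the flex chart of
`…TameThreeTorsionCongruence` (`s = α/3`, `c₄ = 144s(9s³ − 2Y₁)`, `c₆ = −864(Y₁² − 18s³Y₁ + 54s⁶)`, `Δ = 432Y₁³(4s³ − Y₁)`,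
`ord₃ Y₁ ≤ 2`), where «`T` ascends» ⟺ «`9 ∣ Y₁ − 4s³`» (p645684 / p646773):

* `exists_three_velu_three_of_isShortThreeTorsion_of_padicValInt_mod_three_eq_two` — for ANY globally minimal `W` with `9 ∣ N(W)`:
  `ord₃ Δ_min ≡ 2 (mod 3)` ⟹ every rational `3`-torsion point ascends (`ord₃ (4s³ − Y₁) = ord₃ Δ_min − 3 − 3·ord₃ Y₁ ≡ 2`);
* `not_cube_dvd_conductorNorm_of_kodairaSymbolAt_eq_Istar` — type `Iₙ*` at `3` is tame (`f₃ = 2`, Ogg: `ord₃ Δ_min = m + 1`);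
* `padicValInt_minimalDiscriminantInt_eq_five_or_eleven_of_wild_of_exists_three_velu_three` — `27 ∣ N(W)`, `T` ascends ⟹
  `ord₃ Δ_min ∈ {5, 11}`: on the chart an ascent needs `ord₃ (4s³ − Y₁) ≥ 2`, which leaves `(ord₃ Y₁, ord₃ (4s³ − Y₁)) = (0, 2)`
  (`ord₃ Δ = 5`), `(2, 2)` (`ord₃ Δ = 11`), or `(0, ≥ 3)` — and the last is the Papadopoulos–Rizzo row `(2, 3, ≥ 6)` = type `Iₙ*`,
  TAME, against `27 ∣ N(W)`;
* `exists_three_velu_three_iff_of_wild` — **THE WILD DICHOTOMY**: at `27 ∣ N(W)` a rational `3`-torsion point ascends iff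
  `ord₃ Δ_min ∈ {5, 11}` (the strata `IV` with `f₃ = 3` and `IV*` with `f₃ = 5` of an's chart table, MEMO-an §67.12);
* `noAscendingWild_iff_wildPositionLaw` — **NB₃^V-wild (stub 4b^W VERBATIM) ⟺ the WILD POSITION LAW T3W** «a lattice-optimal `W`,
  `9 ∣ N`, `27 ∣ N(W)`, with a rational `3`-torsion point on `E♮` has `ord₃ Δ_min ∉ {5, 11}`»; and
  `noAscendingThreeTorsionOptimal_iff_positionLaws` — **NB₃^V ⟺ T3III ∧ T3W GIVEN modularity** (`N = N(W)`).

HONEST FRAMING: local theorems and equivalences of `c`-free statements; T3III, T3W, NB₃^V, C3, Manin's conjecture and BSD are NOT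
proved.  No definitions, no named facts, no sorry.
References: [SilvermanATAEC1994] IV.9.4, IV.10.2, IV.11.1; [Papadopoulos1993] Table III; [Rizzo2003] Table II;
[DokchitserDokchitser2015LocalInvariants] Table 1; HOME/MEMO-an.md §67.12 (chart-f-rule).
-/

set_option linter.dupNamespace false
set_option autoImplicit false

noncomputable section

open scoped Classical

open WeierstrassCurve IsDedekindDomain NumberField Rat.HeightOneSpectrum Polynomial
  Literature.NumberTheory.DiophantineGeometry Literature.NumberTheory.EllipticCurves
  Literature.NumberTheory.EllipticCurves.ModularForms
  Summit.BirchSwinnertonDyer.Rank1Residual.Additive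
  Summit.BirchSwinnertonDyer.Rank1Residual.ManinAdditive
  Summit.BirchSwinnertonDyer.Rank1Residual.ManinAdditive.CuspidalKummer
  Summit.BirchSwinnertonDyer.Rank1Residual.ManinAdditive.CuspidalKummerThree

namespace Summit.BirchSwinnertonDyer.BirchSwinnertonDyer.Theorems.ManinLocalTwoThree

/-! ### §1 `ord₃ Δ_min ≡ 2 (mod 3)` forces the ascent (any `W` with `9 ∣ N(W)`) -/

/-- **`ord₃ Δ_min ≡ 2 (mod 3)` ⟹ every rational `3`-torsion point of `E♮` ascends** (`W` globally minimal, `9 ∣ N(W)`): on the flex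
chart `ord₃ (4s³ − Y₁) = ord₃ Δ_min − 3 − 3·ord₃ Y₁ ≡ 2 (mod 3)` is `≥ 2`, which is the `z⁹` congruence.
[cite: DokchitserDokchitser2015LocalInvariants, Table 1] [cite: SilvermanAEC2009, III.1 Table 3.1] -/
theorem exists_three_velu_three_of_isShortThreeTorsion_of_padicValInt_mod_three_eq_two (W : WeierstrassCurve ℚ) [W.IsElliptic]
    [W.IsGloballyMinimal] (h9 : 3 ^ 2 ∣ W.conductorNorm ℤ) (hmod : padicValInt 3 W.minimalDiscriminantInt % 3 = 2)
    {X₁ Y₁ : ℚ} (hT : IsShortThreeTorsion W 1 X₁ Y₁) :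
    ∃ W' : WeierstrassCurve ℚ, W'.IsElliptic ∧ W'.IsGloballyMinimal ∧
      (3 : ℚ) ^ 4 * W'.c₄ = 1440 * X₁ ^ 2 - 9 * W.c₄ ∧
      (3 : ℚ) ^ 6 * W'.c₆ = 60480 * X₁ ^ 3 - 756 * W.c₄ * X₁ - 27 * W.c₆ := by
  obtain ⟨hA, hB⟩ := norm_shortModel_le_one_of_nine_dvd_conductorNorm W h9
  obtain ⟨hXn, hYn⟩ := norm_le_one_of_isShortThreeTorsion W hA hB hT
  have hsn := norm_tangentSlope_div_three_le_one hT hXn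
  obtain ⟨-, -, hΔ⟩ := c₄_c₆_Δ_eq_of_isShortThreeTorsion_flex W hT
  set s : ℚ := tangentSlope W 1 X₁ Y₁ / 3 with hs
  have hY0 : Y₁ ≠ 0 := y_ne_zero_of_isShortThreeTorsion hT
  have v9 : padicValRat 3 (9 : ℚ) = 2 := by exact_mod_cast padicValRat_three_natCast_of_eq 2 (m := 1) (by norm_num) (by norm_num)
  have v432 : padicValRat 3 (432 : ℚ) = 3 := by exact_mod_cast padicValRat_three_natCast_of_eq 3 (m := 16) (by norm_num) (by norm_num)
  have hD0 : 4 * s ^ 3 - Y₁ ≠ 0 := by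
    intro h; apply W.isUnit_Δ.ne_zero; rw [hΔ, h, mul_zero]
  have hΔmin := padicValInt_minimalDiscriminantInt_eq_padicValRat_Δ W
  have vΔ : padicValRat 3 W.Δ = 3 + 3 * padicValRat 3 Y₁ + padicValRat 3 (4 * s ^ 3 - Y₁) := by
    rw [hΔ, padicValRat_three_mul₃ (by norm_num) (pow_ne_zero 3 hY0) hD0, padicValRat.pow, v432]; push_cast; ring
  have vD0 : 0 ≤ padicValRat 3 (4 * s ^ 3 - Y₁) := by
    apply (norm_ratCast_padicThree_le_one_iff _).mp
    push_cast
    have h4 : ‖(4 : ℚ_[3])‖ ≤ 1 := by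
      have := norm_natCast_padicThree_eq_one (n := 4) (by norm_num)
      rw [Nat.cast_ofNat] at this; exact this.le
    calc ‖(4 : ℚ_[3]) * ((s : ℚ) : ℚ_[3]) ^ 3 - ((Y₁ : ℚ) : ℚ_[3])‖
        ≤ max ‖(4 : ℚ_[3]) * ((s : ℚ) : ℚ_[3]) ^ 3‖ ‖((Y₁ : ℚ) : ℚ_[3])‖ := by
          rw [sub_eq_add_neg]
          exact (Padic.nonarchimedean _ _).trans (by rw [norm_neg])
      _ ≤ max 1 1 := by
          refine max_le_max ?_ hYn
          rw [norm_mul, norm_pow]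
          exact mul_le_one₀ h4 (by positivity) (pow_le_one₀ (norm_nonneg _) hsn)
      _ = 1 := max_self 1
  -- `ord₃ (4s³ − Y₁) ≡ 2 (mod 3)` and `≥ 0`, hence `≥ 2`
  have hv : 2 ≤ padicValRat 3 (Y₁ - 4 * s ^ 3) := by
    rw [show Y₁ - 4 * s ^ 3 = -(4 * s ^ 3 - Y₁) by ring, padicValRat.neg]
    have hz : (padicValInt 3 W.minimalDiscriminantInt : ℤ) % 3 = 2 := by exact_mod_cast hmod
    rw [hΔmin, vΔ] at hz
    omega
  have hne : Y₁ - 4 * s ^ 3 ≠ 0 := fun h ↦ hD0 (by linear_combination -h)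
  refine exists_isGloballyMinimal_three_velu_three_of_congruence W hA hB hT ?_
  apply (norm_ratCast_padicThree_le_one_iff _).mpr
  rw [padicValRat.div hne (by norm_num), v9]; omega

/-! ### §2 Type `Iₙ*` at `3` is tame -/

/-- **Type `Iₙ*` at `3` ⟹ `27 ∤ N(W)`**: Ogg's formula on the tame types (`ord₃ Δ_min = m + 1`, tree
`conductorExponent_eq_two_of_kodairaSymbolAt`) gives `f₃ = 2`, and `f₃` is the exponent of `3` in `N(W)` (`factorization_conductorNorm`).
[cite: SilvermanATAEC1994, IV.10.2 and IV.11.1] -/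
theorem not_cube_dvd_conductorNorm_of_kodairaSymbolAt_eq_Istar (W : WeierstrassCurve ℚ) [W.IsElliptic] {n : ℕ}
    (hK : W.kodairaSymbolAt (placeOf 3) = .Istar n) : ¬ 3 ^ 3 ∣ W.conductorNorm ℤ := by
  haveI : PerfectField (IsLocalRing.ResidueField ((placeOf 3).adicCompletionIntegers ℚ)) := PerfectField.ofFinite
  have h2 : ringChar (ℤ ⧸ (placeOf 3).asIdeal) ≠ 2 := by rw [ringChar_int_quot_placeOf 3]; decide
  have hf : W.conductorExponent (placeOf 3) = 2 :=
    W.conductorExponent_eq_two_of_kodairaSymbolAt (placeOf 3) h2 (Or.inr (Or.inr ⟨n, hK⟩))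
  have hgen : natGenerator (placeOf 3) = 3 :=
    congrArg Subtype.val ((primesEquiv (R := ℤ)).apply_symm_apply ⟨3, Nat.prime_three⟩)
  have hfac : (W.conductorNorm ℤ).factorization 3 = 2 := by
    rw [← hgen, factorization_conductorNorm_holds W (placeOf 3), hf]
  intro h27
  have hN0 : W.conductorNorm ℤ ≠ 0 := (W.conductorNorm_pos_holds).ne'
  have : 3 ≤ (W.conductorNorm ℤ).factorization 3 := (Nat.prime_three.pow_dvd_iff_le_factorization hN0).mp h27
  omega

/-- Reduction shift of Rizzo's Table II on a row `(2, 3, c)`, `c ≥ 0`: zero. [cite: Rizzo2003, §1.1 (p. 3)] -/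
theorem kellockDokchitser_shift_two_three (c : ℤ) (hc : 0 ≤ c) :
    KellockDokchitser.shift c ((3 : ℤ) : WithTop ℤ) ((2 : ℤ) : WithTop ℤ) = 0 := by
  simp only [KellockDokchitser.shift]
  have h1 : (3 : ℤ) / 6 = 0 := by decide
  have h2 : (2 : ℤ) / 4 = 0 := by decide
  rw [h1, h2]
  have h3 : 0 ≤ c / 12 := Int.ediv_nonneg hc (by norm_num)
  omega

/-! ### §3 At `27 ∣ N(W)` an ascent forces `ord₃ Δ_min ∈ {5, 11}` -/

/-- **`27 ∣ N(W)`, `T` a rational `3`-torsion point of `E♮` whose Vélu `3`-quotient ascends ⟹ `ord₃ Δ_min(W) ∈ {5, 11}`.**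
On the flex chart the ascent is `ord₃ (4s³ − Y₁) ≥ 2`; with `ord₃ Y₁ ∈ {0, 1, 2}` and `s ∈ ℤ₃` this leaves `(ord₃ Y₁, ord₃(4s³ − Y₁)) =
(0, 2)` (`ord₃ Δ = 5`), `(2, 2)` (`ord₃ Δ = 11`) or `(0, ≥ 3)` — and the last gives the Papadopoulos–Rizzo triple `(2, 3, ≥ 6)`, type
`Iₙ*`, tame, against `27 ∣ N(W)`. [cite: Papadopoulos1993, Table III (p = 3)] [cite: Rizzo2003, Table II (p. 4)]
[cite: SilvermanATAEC1994, IV.9.4 Table 4.1] -/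
theorem padicValInt_minimalDiscriminantInt_eq_five_or_eleven_of_wild_of_exists_three_velu_three (W : WeierstrassCurve ℚ)
    [W.IsElliptic] [W.IsGloballyMinimal] (h27 : 3 ^ 3 ∣ W.conductorNorm ℤ) {X₁ Y₁ : ℚ} (hT : IsShortThreeTorsion W 1 X₁ Y₁)
    (hasc : ∃ W' : WeierstrassCurve ℚ, W'.IsElliptic ∧ W'.IsGloballyMinimal ∧
      (3 : ℚ) ^ 4 * W'.c₄ = 1440 * X₁ ^ 2 - 9 * W.c₄ ∧
      (3 : ℚ) ^ 6 * W'.c₆ = 60480 * X₁ ^ 3 - 756 * W.c₄ * X₁ - 27 * W.c₆) :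
    padicValInt 3 W.minimalDiscriminantInt = 5 ∨ padicValInt 3 W.minimalDiscriminantInt = 11 := by
  have h9 : 3 ^ 2 ∣ W.conductorNorm ℤ := dvd_trans (pow_dvd_pow 3 (by norm_num)) h27
  obtain ⟨hA, hB⟩ := norm_shortModel_le_one_of_nine_dvd_conductorNorm W h9
  obtain ⟨hXn, hYn⟩ := norm_le_one_of_isShortThreeTorsion W hA hB hT
  have hsn := norm_tangentSlope_div_three_le_one hT hXn
  have hY27 := one_lt_norm_div_twentyseven_of_isShortThreeTorsion W hA hB hT
  have hcong := (exists_isGloballyMinimal_three_velu_three_iff_congruence W hA hB hT).mp hasc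
  obtain ⟨hc4, hc6, hΔ⟩ := c₄_c₆_Δ_eq_of_isShortThreeTorsion_flex W hT
  set s : ℚ := tangentSlope W 1 X₁ Y₁ / 3 with hs
  have hY0 : Y₁ ≠ 0 := y_ne_zero_of_isShortThreeTorsion hT
  -- numeral valuations
  have v2 : padicValRat 3 (2 : ℚ) = 0 := by exact_mod_cast padicValRat_three_natCast_of_eq 0 (m := 2) (by norm_num) (by norm_num)
  have v4 : padicValRat 3 (4 : ℚ) = 0 := by exact_mod_cast padicValRat_three_natCast_of_eq 0 (m := 4) (by norm_num) (by norm_num)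
  have v9 : padicValRat 3 (9 : ℚ) = 2 := by exact_mod_cast padicValRat_three_natCast_of_eq 2 (m := 1) (by norm_num) (by norm_num)
  have v18 : padicValRat 3 (18 : ℚ) = 2 := by exact_mod_cast padicValRat_three_natCast_of_eq 2 (m := 2) (by norm_num) (by norm_num)
  have v27 : padicValRat 3 (27 : ℚ) = 3 := by exact_mod_cast padicValRat_three_natCast_of_eq 3 (m := 1) (by norm_num) (by norm_num)
  have v54 : padicValRat 3 (54 : ℚ) = 3 := by exact_mod_cast padicValRat_three_natCast_of_eq 3 (m := 2) (by norm_num) (by norm_num)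
  have v144 : padicValRat 3 (144 : ℚ) = 2 := by exact_mod_cast padicValRat_three_natCast_of_eq 2 (m := 16) (by norm_num) (by norm_num)
  have v432 : padicValRat 3 (432 : ℚ) = 3 := by exact_mod_cast padicValRat_three_natCast_of_eq 3 (m := 16) (by norm_num) (by norm_num)
  have v864 : padicValRat 3 (-864 : ℚ) = 3 := by
    rw [padicValRat.neg]; exact_mod_cast padicValRat_three_natCast_of_eq 3 (m := 32) (by norm_num) (by norm_num)
  -- valuations of the data
  have vY0 : 0 ≤ padicValRat 3 Y₁ := (norm_ratCast_padicThree_le_one_iff Y₁).mp hYn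
  have vY2 : padicValRat 3 Y₁ ≤ 2 := by
    have h : ¬ 0 ≤ padicValRat 3 (Y₁ / 27) := fun h' ↦
      (not_le.mpr hY27) ((norm_ratCast_padicThree_le_one_iff (Y₁ / 27)).mpr h')
    rw [padicValRat.div hY0 (by norm_num), v27] at h
    omega
  have vs : s = 0 ∨ 0 ≤ padicValRat 3 s := by
    by_cases h : s = 0
    · exact Or.inl h
    · exact Or.inr ((norm_ratCast_padicThree_le_one_iff s).mp hsn)
  have hD0 : 4 * s ^ 3 - Y₁ ≠ 0 := by
    intro h; apply W.isUnit_Δ.ne_zero; rw [hΔ, h, mul_zero]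
  have hΔmin := padicValInt_minimalDiscriminantInt_eq_padicValRat_Δ W
  have vΔ : padicValRat 3 W.Δ = 3 + 3 * padicValRat 3 Y₁ + padicValRat 3 (4 * s ^ 3 - Y₁) := by
    rw [hΔ, padicValRat_three_mul₃ (by norm_num) (pow_ne_zero 3 hY0) hD0, padicValRat.pow, v432]; push_cast; ring
  -- the ascent in valuation terms: `ord₃ (4s³ − Y₁) ≥ 2`
  have hne : Y₁ - 4 * s ^ 3 ≠ 0 := fun h ↦ hD0 (by linear_combination -h)
  have vD2 : 2 ≤ padicValRat 3 (4 * s ^ 3 - Y₁) := by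
    have h := (norm_ratCast_padicThree_le_one_iff _).mp hcong
    rw [padicValRat.div hne (by norm_num), v9, show Y₁ - 4 * s ^ 3 = -(4 * s ^ 3 - Y₁) by ring, padicValRat.neg] at h
    omega
  -- the conclusion in valuation terms
  suffices hv : padicValRat 3 W.Δ = 5 ∨ padicValRat 3 W.Δ = 11 by
    rcases hv with h | h
    · left; have := hΔmin; rw [h] at this; exact_mod_cast this
    · right; have := hΔmin; rw [h] at this; exact_mod_cast this
  have hYcases : padicValRat 3 Y₁ = 0 ∨ padicValRat 3 Y₁ = 1 ∨ padicValRat 3 Y₁ = 2 := by omega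
  rcases hYcases with hv0 | hv1 | hv2
  · -- `ord₃ Y₁ = 0`: `s` must be a unit; `ord₃ (4s³ − Y₁) = 2` gives `ord₃ Δ = 5`, `≥ 3` gives the tame type `Iₙ*`
    have hsz : s ≠ 0 := by
      intro h
      rw [show 4 * s ^ 3 - Y₁ = -Y₁ by rw [h]; ring, padicValRat.neg, hv0] at vD2
      exact absurd vD2 (by norm_num)
    have hsv : padicValRat 3 s = 0 := by
      rcases vs with h | h
      · exact absurd h hsz
      by_contra hne1
      have : padicValRat 3 (-Y₁ + 4 * s ^ 3) = 0 := by
        rw [padicValRat_three_add_eq_of_lt (neg_ne_zero.mpr hY0) ?_, padicValRat.neg, hv0]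
        intro _
        rw [padicValRat.neg, hv0, padicValRat.mul (by norm_num) (pow_ne_zero 3 hsz), padicValRat.pow, v4]
        push_cast; omega
      rw [show -Y₁ + 4 * s ^ 3 = 4 * s ^ 3 - Y₁ by ring] at this
      omega
    by_cases hD2 : padicValRat 3 (4 * s ^ 3 - Y₁) = 2
    · left; rw [vΔ, hv0, hD2]; norm_num
    · -- `ord₃ (4s³ − Y₁) ≥ 3`: the triple `(2, 3, ≥ 6)` = `Iₙ*`, tame
      exfalso
      have vD3 : 3 ≤ padicValRat 3 (4 * s ^ 3 - Y₁) := by omega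
      -- `ord₃ c₄ = 2`
      have h92 : 9 * s ^ 3 - 2 * Y₁ ≠ 0 ∧ padicValRat 3 (9 * s ^ 3 - 2 * Y₁) = 0 := by
        have hq : -(2 * Y₁) ≠ 0 := neg_ne_zero.mpr (mul_ne_zero two_ne_zero hY0)
        have hvq : padicValRat 3 (-(2 * Y₁)) = 0 := by rw [padicValRat.neg, padicValRat.mul two_ne_zero hY0, v2, hv0]; ring
        have h9s : padicValRat 3 (9 * s ^ 3) = 2 := by
          rw [padicValRat.mul (by norm_num) (pow_ne_zero 3 hsz), padicValRat.pow, v9, hsv]; ring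
        have heq : padicValRat 3 (-(2 * Y₁) + 9 * s ^ 3) = 0 := by
          rw [padicValRat_three_add_eq_of_lt hq ?_, hvq]
          intro _; rw [hvq, h9s]; norm_num
        have e : 9 * s ^ 3 - 2 * Y₁ = -(2 * Y₁) + 9 * s ^ 3 := by ring
        refine ⟨?_, by rw [e, heq]⟩
        intro h0
        have : 9 * s ^ 3 = 2 * Y₁ := by linear_combination h0
        have hv' : padicValRat 3 (9 * s ^ 3) = padicValRat 3 (2 * Y₁) := by rw [this]
        rw [h9s, padicValRat.mul two_ne_zero hY0, v2, hv0] at hv'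
        norm_num at hv'
      have hc40 : W.c₄ ≠ 0 := by
        rw [hc4]; exact mul_ne_zero (mul_ne_zero (by norm_num) hsz) h92.1
      have vc4 : padicValRat 3 W.c₄ = 2 := by
        rw [hc4, padicValRat_three_mul₃ (by norm_num) hsz h92.1, v144, hsv, h92.2]; norm_num
      -- `ord₃ c₆ = 3`
      have hin : Y₁ ^ 2 - 18 * s ^ 3 * Y₁ + 54 * s ^ 6 ≠ 0 ∧
          padicValRat 3 (Y₁ ^ 2 - 18 * s ^ 3 * Y₁ + 54 * s ^ 6) = 0 := by
        have hY2 : Y₁ ^ 2 ≠ 0 := pow_ne_zero 2 hY0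
        have vY2' : padicValRat 3 (Y₁ ^ 2) = 0 := by rw [padicValRat.pow, hv0]; norm_num
        have e : Y₁ ^ 2 - 18 * s ^ 3 * Y₁ + 54 * s ^ 6 = Y₁ ^ 2 + (-(18 * s ^ 3 * Y₁) + 54 * s ^ 6) := by ring
        have hrest : -(18 * s ^ 3 * Y₁) + 54 * s ^ 6 ≠ 0 →
            padicValRat 3 (Y₁ ^ 2) < padicValRat 3 (-(18 * s ^ 3 * Y₁) + 54 * s ^ 6) := by
          intro hr
          rw [vY2']
          have ha : padicValRat 3 (-(18 * s ^ 3 * Y₁)) = 2 := by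
            rw [padicValRat.neg, padicValRat_three_mul₃ (by norm_num) (pow_ne_zero 3 hsz) hY0, padicValRat.pow,
              v18, hsv, hv0]; norm_num
          have hb : padicValRat 3 (54 * s ^ 6) = 3 := by
            rw [padicValRat.mul (by norm_num) (pow_ne_zero 6 hsz), padicValRat.pow, v54, hsv]; norm_num
          have hmin := padicValRat.min_le_padicValRat_add (p := 3) hr
          rw [ha, hb] at hmin
          have : min (2 : ℤ) 3 = 2 := by norm_num
          rw [this] at hmin
          omega
        have heq : padicValRat 3 (Y₁ ^ 2 + (-(18 * s ^ 3 * Y₁) + 54 * s ^ 6)) = 0 := by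
          rw [padicValRat_three_add_eq_of_lt hY2 hrest, vY2']
        refine ⟨?_, by rw [e, heq]⟩
        intro h0
        rw [e] at h0
        by_cases hr : -(18 * s ^ 3 * Y₁) + 54 * s ^ 6 = 0
        · rw [hr, add_zero] at h0; exact hY2 h0
        · have hlt' := hrest hr
          have : -(18 * s ^ 3 * Y₁) + 54 * s ^ 6 = -(Y₁ ^ 2) := by linear_combination h0
          rw [this, padicValRat.neg] at hlt'
          exact lt_irrefl _ hlt'
      have hc60 : W.c₆ ≠ 0 := by rw [hc6]; exact mul_ne_zero (by norm_num) hin.1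
      have vc6 : padicValRat 3 W.c₆ = 3 := by
        rw [hc6, padicValRat.mul (by norm_num) hin.1, v864, hin.2]; norm_num
      -- Rizzo's Table II (= Tate's algorithm at `3`), row `(2, 3, ≥ 6)`: type `Iₙ*`
      have hc6le : 6 ≤ padicValRat 3 W.Δ := by rw [vΔ, hv0]; omega
      have hK : W.kodairaSymbolAt (placeOf 3) = .Istar (padicValRat 3 W.Δ - 6).toNat := by
        rw [W.kodairaSymbolAt_eq_tableKodairaSymbolThree (ringChar_int_quot_placeOf 3), tableKodairaSymbolThree_def,
          Rizzo.kodairaOfInvariants_eq_of_shift_zero (a := ((2 : ℤ) : WithTop ℤ)) (b := ((3 : ℤ) : WithTop ℤ))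
            (c := padicValRat 3 W.Δ) (k := 0) ?_ ?_ ?_ (kellockDokchitser_shift_two_three _ (by omega))]
        · exact Rizzo.kodaira_row_2_3_ge6 hc6le _ _ _
        · rw [Rizzo.val3, if_neg hc40, vc4]; rfl
        · rw [Rizzo.val3, if_neg hc60, vc6]; rfl
        · ring
      exact not_cube_dvd_conductorNorm_of_kodairaSymbolAt_eq_Istar W hK h27
  · -- `ord₃ Y₁ = 1`: no ascent at all (`ord₃ (4s³ − Y₁) ≤ 1`)
    exfalso
    rcases vs with hsz | hs0
    · rw [show 4 * s ^ 3 - Y₁ = -Y₁ by rw [hsz]; ring, padicValRat.neg, hv1] at vD2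
      exact absurd vD2 (by norm_num)
    · have hsz : s ≠ 0 ∨ s = 0 := (em (s = 0)).symm
      rcases hsz with hsz | hsz
      · by_cases hsv : padicValRat 3 s = 0
        · have vs3 : padicValRat 3 (4 * s ^ 3) = 0 := by
            rw [padicValRat.mul (by norm_num) (pow_ne_zero 3 hsz), padicValRat.pow, v4, hsv]; ring
          have : padicValRat 3 (4 * s ^ 3 - Y₁) = 0 := by
            rw [sub_eq_add_neg, padicValRat_three_add_eq_of_lt (mul_ne_zero (by norm_num) (pow_ne_zero 3 hsz)) ?_, vs3]
            intro _; rw [vs3, padicValRat.neg, hv1]; norm_num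
          omega
        · have : padicValRat 3 (-Y₁ + 4 * s ^ 3) = 1 := by
            rw [padicValRat_three_add_eq_of_lt (neg_ne_zero.mpr hY0) ?_, padicValRat.neg, hv1]
            intro _
            rw [padicValRat.neg, hv1, padicValRat.mul (by norm_num) (pow_ne_zero 3 hsz), padicValRat.pow, v4]
            push_cast; omega
          rw [show -Y₁ + 4 * s ^ 3 = 4 * s ^ 3 - Y₁ by ring] at this
          omega
      · rw [show 4 * s ^ 3 - Y₁ = -Y₁ by rw [hsz]; ring, padicValRat.neg, hv1] at vD2
        exact absurd vD2 (by norm_num)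
  · -- `ord₃ Y₁ = 2`: `ord₃ (4s³ − Y₁) = 2` unless `s` is a unit (and then there is no ascent); so `ord₃ Δ = 11`
    right
    have vD : padicValRat 3 (4 * s ^ 3 - Y₁) = 2 := by
      rcases vs with hsz | hs0
      · rw [show 4 * s ^ 3 - Y₁ = -Y₁ by rw [hsz]; ring, padicValRat.neg, hv2]
      · by_cases hsz : s = 0
        · rw [show 4 * s ^ 3 - Y₁ = -Y₁ by rw [hsz]; ring, padicValRat.neg, hv2]
        by_cases hsv : padicValRat 3 s = 0
        · exfalso
          have vs3 : padicValRat 3 (4 * s ^ 3) = 0 := by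
            rw [padicValRat.mul (by norm_num) (pow_ne_zero 3 hsz), padicValRat.pow, v4, hsv]; ring
          have : padicValRat 3 (4 * s ^ 3 - Y₁) = 0 := by
            rw [sub_eq_add_neg, padicValRat_three_add_eq_of_lt (mul_ne_zero (by norm_num) (pow_ne_zero 3 hsz)) ?_, vs3]
            intro _; rw [vs3, padicValRat.neg, hv2]; norm_num
          omega
        · rw [show 4 * s ^ 3 - Y₁ = -Y₁ + 4 * s ^ 3 by ring,
            padicValRat_three_add_eq_of_lt (neg_ne_zero.mpr hY0) ?_, padicValRat.neg, hv2]
          intro _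
          rw [padicValRat.neg, hv2, padicValRat.mul (by norm_num) (pow_ne_zero 3 hsz), padicValRat.pow, v4]
          push_cast; omega
    rw [vΔ, hv2, vD]; norm_num

/-! ### §4 THE WILD DICHOTOMY and the stub equivalence NB₃^V-wild ⟺ T3W -/

/-- **THE WILD DICHOTOMY:** `W` globally minimal, `27 ∣ N(W)`, `T` a rational `3`-torsion point of `E♮`: `T`'s Vélu `3`-quotient
ascends **iff** `ord₃ Δ_min(W) ∈ {5, 11}` (the strata `IV`, `f₃ = 3` and `IV*`, `f₃ = 5`).
[cite: SilvermanATAEC1994, IV.9.4 Table 4.1] [cite: Papadopoulos1993, Table III (p = 3)] -/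
theorem exists_three_velu_three_iff_of_wild (W : WeierstrassCurve ℚ) [W.IsElliptic] [W.IsGloballyMinimal]
    (h27 : 3 ^ 3 ∣ W.conductorNorm ℤ) {X₁ Y₁ : ℚ} (hT : IsShortThreeTorsion W 1 X₁ Y₁) :
    (∃ W' : WeierstrassCurve ℚ, W'.IsElliptic ∧ W'.IsGloballyMinimal ∧
      (3 : ℚ) ^ 4 * W'.c₄ = 1440 * X₁ ^ 2 - 9 * W.c₄ ∧
      (3 : ℚ) ^ 6 * W'.c₆ = 60480 * X₁ ^ 3 - 756 * W.c₄ * X₁ - 27 * W.c₆) ↔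
    (padicValInt 3 W.minimalDiscriminantInt = 5 ∨ padicValInt 3 W.minimalDiscriminantInt = 11) := by
  constructor
  · exact padicValInt_minimalDiscriminantInt_eq_five_or_eleven_of_wild_of_exists_three_velu_three W h27 hT
  · intro h
    have h9 : 3 ^ 2 ∣ W.conductorNorm ℤ := dvd_trans (pow_dvd_pow 3 (by norm_num)) h27
    refine exists_three_velu_three_of_isShortThreeTorsion_of_padicValInt_mod_three_eq_two W h9 ?_ hT
    rcases h with h | h <;> rw [h]

/-- **NB₃^V-wild ⟺ T3W.**  The v15 stub 4b^W of line `kato_shift_three` (NB₃^V restricted to `27 ∣ N(W)`, left side VERBATIM) is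
EQUIVALENT to the WILD POSITION LAW T3W «a lattice-optimal `W` with `9 ∣ N`, `27 ∣ N(W)` and a rational `3`-torsion point on `E♮`
has `ord₃ Δ_min ∉ {5, 11}`» (right side).  Both are `c`-free OPTIMALITY laws and stay OPEN.
[cite: SilvermanATAEC1994, IV.9.4 Table 4.1] -/
theorem noAscendingWild_iff_wildPositionLaw :
    (∀ (W : WeierstrassCurve ℚ) [W.IsElliptic] [W.IsGloballyMinimal] {N : ℕ} [NeZero N]
      (D : ModularParametrizationData W N),
      (∀ z ∈ D.L.lattice, ∃ w ∈ periodLattice D.f, z = D.c * w) → 9 ∣ N → 3 ^ 3 ∣ W.conductorNorm ℤ →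
      ∀ X₁ Y₁ : ℚ, IsShortThreeTorsion W 1 X₁ Y₁ →
      ¬ ∃ W' : WeierstrassCurve ℚ, W'.IsElliptic ∧ W'.IsGloballyMinimal ∧
          (3 : ℚ) ^ 4 * W'.c₄ = 1440 * X₁ ^ 2 - 9 * W.c₄ ∧
          (3 : ℚ) ^ 6 * W'.c₆ = 60480 * X₁ ^ 3 - 756 * W.c₄ * X₁ - 27 * W.c₆) ↔
    (∀ (W : WeierstrassCurve ℚ) [W.IsElliptic] [W.IsGloballyMinimal] {N : ℕ} [NeZero N]
      (D : ModularParametrizationData W N),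
      (∀ z ∈ D.L.lattice, ∃ w ∈ periodLattice D.f, z = D.c * w) → 9 ∣ N → 3 ^ 3 ∣ W.conductorNorm ℤ →
      ∀ X₁ Y₁ : ℚ, IsShortThreeTorsion W 1 X₁ Y₁ →
        padicValInt 3 W.minimalDiscriminantInt ≠ 5 ∧ padicValInt 3 W.minimalDiscriminantInt ≠ 11) := by
  constructor
  · intro hno W _ _ N _ D hL h9 h27 X₁ Y₁ hT
    have h := hno W D hL h9 h27 X₁ Y₁ hT
    rw [exists_three_velu_three_iff_of_wild W h27 hT] at h
    exact ⟨fun h5 ↦ h (Or.inl h5), fun h11 ↦ h (Or.inr h11)⟩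
  · intro hpos W _ _ N _ D hL h9 h27 X₁ Y₁ hT hasc
    obtain ⟨h5, h11⟩ := hpos W D hL h9 h27 X₁ Y₁ hT
    rcases (exists_three_velu_three_iff_of_wild W h27 hT).mp hasc with h | h
    · exact h5 h
    · exact h11 h

/-- **NB₃^V ⟺ T3III ∧ T3W, GIVEN modularity.**  The v14 stub `NoAscendingThreeTorsionOptimal` of line `kato_shift_three` is
EQUIVALENT to the conjunction of the two Kodaira POSITION LAWS for `X₀(N)`-optimal curves carrying a rational `3`-torsion point on
`E♮`: T3III on the tame band («type `III`») and T3W on the wild band («`ord₃ Δ_min ∉ {5, 11}`»); `exists_isNewformOf` turns the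
datum's level into the conductor.  Both sides OPEN; nothing about C3, Manin's conjecture or BSD is proved.
[cite: DiamondShurman2005, Thm. 5.8.2] [cite: SilvermanATAEC1994, IV.9.4 Table 4.1] -/
theorem noAscendingThreeTorsionOptimal_iff_positionLaws (hnf : exists_isNewformOf) :
    NoAscendingThreeTorsionOptimal ↔
    ((∀ (W : WeierstrassCurve ℚ) [W.IsElliptic] [W.IsGloballyMinimal] {N : ℕ} [NeZero N]
        (D : ModularParametrizationData W N),
        (∀ z ∈ D.L.lattice, ∃ w ∈ periodLattice D.f, z = D.c * w) → 9 ∣ N →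
        3 ^ 2 ∣ W.conductorNorm ℤ → ¬ 3 ^ 3 ∣ W.conductorNorm ℤ →
          ∀ X₁ Y₁ : ℚ, IsShortThreeTorsion W 1 X₁ Y₁ → padicValInt 3 W.minimalDiscriminantInt = 3) ∧
      (∀ (W : WeierstrassCurve ℚ) [W.IsElliptic] [W.IsGloballyMinimal] {N : ℕ} [NeZero N]
        (D : ModularParametrizationData W N),
        (∀ z ∈ D.L.lattice, ∃ w ∈ periodLattice D.f, z = D.c * w) → 9 ∣ N → 3 ^ 3 ∣ W.conductorNorm ℤ →
        ∀ X₁ Y₁ : ℚ, IsShortThreeTorsion W 1 X₁ Y₁ →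
          padicValInt 3 W.minimalDiscriminantInt ≠ 5 ∧ padicValInt 3 W.minimalDiscriminantInt ≠ 11)) := by
  constructor
  · intro h
    refine ⟨typeIIILaw_of_noAscendingThreeTorsionOptimal h, ?_⟩
    exact noAscendingWild_iff_wildPositionLaw.mp (fun W _ _ N _ D hL h9 _ X₁ Y₁ hT ↦ h W D hL h9 X₁ Y₁ hT)
  · rintro ⟨h112, hW⟩
    refine noAscendingThreeTorsionOptimal_of_typeIIILaw_of_wild hnf h112 ?_
    exact noAscendingWild_iff_wildPositionLaw.mpr hW

end Summit.BirchSwinnertonDyer.BirchSwinnertonDyer.Theorems.ManinLocalTwoThree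

end
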